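import Mathlib

/-!
# ValiantsHypothesis / RigidityForcesSymmetry — crux `LaplaceOptimalFive` (stmt-ValiantsHypothesis-24813), line
`Cruxes/LaplaceOptimalFive/Lines/shallow_collision.lean` («shallow-collision ledger»), stub S1 `stub_onShell_five`:
BASICS of the on-shell bookkeeping.

An ON-SHELL cylindrical term system for `P₅` (words `v : Fin 5 → Fin 5`, terms `t` with slot set `S t`, short factor `u t`
read on `S t`, long factor `w t` read off `S t`) has, for every `t`, `u t v = 0` unless `v` is injective on `S t`,
`u t v` depending only on the letter SET `(S t).image v`, and likewise `w t` on `(S t)ᶜ` (the line's `OnShellAll S u w`,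
UNFOLDED here as four hypotheses).  This file proves the elementary consequences used by the S1 closer:

* `mul_eq_zero_of_mem_mem` / `mul_eq_zero_of_not_mem_not_mem` : a term's product `u t v * w t v` vanishes at a word with a
  collision `v p = v q` that is NOT cut by the split `S t`;
* `mul_congr_of_image_eq` / `fiber_congr` : products (and their sums over a fiber `{t ∈ T | S t = S₀}`) only see image sets;
* `sum_eq_sum_map_fiber` : at a word with a collision `v p = v q`, the exactness sum `∑_{t ∈ T} u t v * w t v` regroups as the
  sum, over any duplicate-free list of slot sets containing every set separating `p` from `q`, of the fiber sums;
* `weight_ge_of_fibers` : the Laplace weight `∑_{t ∈ T} |S t|!(5−|S t|)!` is at least the total weight of any family of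
  pairwise non-complementary slot sets each of whose flattening `{S₀, S₀ᶜ}` carries a term of `T`.

Honest framing.  Helper lemmas only; nothing here proves S1, `LaplaceOptimalFive` (OPEN), `RankRigidMinimalRepr` or
`VP ≠ VNP`.  No definitions, no `sorry`; Mathlib only.
-/

-- `Summit.ValiantsHypothesis.ValiantsHypothesis.…` is the tree's mandated single-conjunct layout (Sub = Summit).
set_option linter.dupNamespace false

namespace Summit.ValiantsHypothesis.ValiantsHypothesis.Theorems.RigidityForcesSymmetryRankRigidMinimalRepr

namespace LaplaceFiveOnShell

open Finset

variable {N : ℕ} (T : Finset (Fin N)) (S : Fin N → Finset (Fin 5)) (u w : Fin N → (Fin 5 → Fin 5) → ℂ)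

/-- A non-injective map on a finset has a strictly smaller image. [folklore] -/
theorem card_image_lt_of_collision (S₀ : Finset (Fin 5)) (v : Fin 5 → Fin 5) {p q : Fin 5} (hp : p ∈ S₀) (hq : q ∈ S₀)
    (hpq : p ≠ q) (hv : v p = v q) : (S₀.image v).card < S₀.card := by
  refine lt_of_le_of_ne Finset.card_image_le fun h => hpq ?_
  exact (Finset.card_image_iff.mp h) hp hq hv

/-- A collision inside `S t` kills the short factor, hence the product. [folklore] -/
theorem mul_eq_zero_of_mem_mem (ho1 : ∀ t v, ((S t).image v).card < (S t).card → u t v = 0)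
    (t : Fin N) (v : Fin 5 → Fin 5) {p q : Fin 5} (hp : p ∈ S t) (hq : q ∈ S t) (hpq : p ≠ q) (hv : v p = v q) :
    u t v * w t v = 0 := by
  rw [ho1 t v (card_image_lt_of_collision (S t) v hp hq hpq hv), zero_mul]

/-- A collision outside `S t` kills the long factor, hence the product. [folklore] -/
theorem mul_eq_zero_of_not_mem_not_mem (ho3 : ∀ t v, (((S t)ᶜ).image v).card < ((S t)ᶜ).card → w t v = 0)
    (t : Fin N) (v : Fin 5 → Fin 5) {p q : Fin 5} (hp : p ∉ S t) (hq : q ∉ S t) (hpq : p ≠ q) (hv : v p = v q) :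
    u t v * w t v = 0 := by
  rw [ho3 t v (card_image_lt_of_collision (S t)ᶜ v (Finset.mem_compl.mpr hp) (Finset.mem_compl.mpr hq) hpq hv),
    mul_zero]

/-- On-shell products only see the two image sets. [folklore] -/
theorem mul_congr_of_image_eq (ho2 : ∀ t v v', (S t).image v = (S t).image v' → u t v = u t v')
    (ho4 : ∀ t v v', ((S t)ᶜ).image v = ((S t)ᶜ).image v' → w t v = w t v')
    (t : Fin N) (v v' : Fin 5 → Fin 5) (h1 : (S t).image v = (S t).image v')
    (h2 : ((S t)ᶜ).image v = ((S t)ᶜ).image v') : u t v * w t v = u t v' * w t v' := by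
  rw [ho2 t v v' h1, ho4 t v v' h2]

/-- Fiber sums (all terms of `T` on a given slot set `S₀`) only see the two image sets. [folklore] -/
theorem fiber_congr (ho2 : ∀ t v v', (S t).image v = (S t).image v' → u t v = u t v')
    (ho4 : ∀ t v v', ((S t)ᶜ).image v = ((S t)ᶜ).image v' → w t v = w t v')
    (S₀ : Finset (Fin 5)) (v v' : Fin 5 → Fin 5) (h1 : S₀.image v = S₀.image v')
    (h2 : (S₀ᶜ).image v = (S₀ᶜ).image v') :
    ∑ t ∈ T.filter (fun t => S t = S₀), u t v * w t v = ∑ t ∈ T.filter (fun t => S t = S₀), u t v' * w t v' := by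
  refine Finset.sum_congr rfl fun t ht => ?_
  have hS : S t = S₀ := (Finset.mem_filter.mp ht).2
  exact mul_congr_of_image_eq S u w ho2 ho4 t v v' (by rw [hS, h1]) (by rw [hS, h2])

/-- A fiber whose slot set does not separate the collision pair contributes nothing. [folklore] -/
theorem fiber_eq_zero_of_not_sep (ho1 : ∀ t v, ((S t).image v).card < (S t).card → u t v = 0)
    (ho3 : ∀ t v, (((S t)ᶜ).image v).card < ((S t)ᶜ).card → w t v = 0)
    (S₀ : Finset (Fin 5)) (v : Fin 5 → Fin 5) {p q : Fin 5} (hpq : p ≠ q) (hv : v p = v q)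
    (hsep : ¬ ((p ∈ S₀ ∧ q ∉ S₀) ∨ (p ∉ S₀ ∧ q ∈ S₀))) :
    ∑ t ∈ T.filter (fun t => S t = S₀), u t v * w t v = 0 := by
  refine Finset.sum_eq_zero fun t ht => ?_
  have hS : S t = S₀ := (Finset.mem_filter.mp ht).2
  by_cases hp : p ∈ S₀
  · have hq : q ∈ S₀ := by
      by_contra hq; exact hsep (Or.inl ⟨hp, hq⟩)
    exact mul_eq_zero_of_mem_mem S u w ho1 t v (hS ▸ hp) (hS ▸ hq) hpq hv
  · have hq : q ∉ S₀ := fun hq => hsep (Or.inr ⟨hp, hq⟩)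
    exact mul_eq_zero_of_not_mem_not_mem S u w ho3 t v (hS ▸ hp) (hS ▸ hq) hpq hv

/-- **Regrouping by fibers.**  At a word with a collision `v p = v q`, the exactness sum over `T` is the sum of the fiber
sums over any duplicate-free list `L` of slot sets that contains every set separating `p` from `q` (fibers off `L` do not
separate the collision, hence vanish). [folklore] -/
theorem sum_eq_sum_map_fiber (ho1 : ∀ t v, ((S t).image v).card < (S t).card → u t v = 0)
    (ho3 : ∀ t v, (((S t)ᶜ).image v).card < ((S t)ᶜ).card → w t v = 0)
    (v : Fin 5 → Fin 5) {p q : Fin 5} (hpq : p ≠ q) (hv : v p = v q)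
    (L : List (Finset (Fin 5))) (hL : L.Nodup)
    (hcov : ∀ S₀ : Finset (Fin 5), ((p ∈ S₀ ∧ q ∉ S₀) ∨ (p ∉ S₀ ∧ q ∈ S₀)) → S₀ ∈ L) :
    ∑ t ∈ T, u t v * w t v
      = (L.map (fun S₀ => ∑ t ∈ T.filter (fun t => S t = S₀), u t v * w t v)).sum := by
  classical
  rw [← List.sum_toFinset _ hL]
  have key : ∀ t ∈ T, u t v * w t v
      = ∑ S₀ ∈ L.toFinset, if S t = S₀ then u t v * w t v else 0 := by
    intro t _
    rw [Finset.sum_ite_eq]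
    by_cases hmem : S t ∈ L.toFinset
    · rw [if_pos hmem]
    · rw [if_neg hmem]
      have hsep : ¬ ((p ∈ S t ∧ q ∉ S t) ∨ (p ∉ S t ∧ q ∈ S t)) :=
        fun h => hmem (List.mem_toFinset.mpr (hcov (S t) h))
      have := fiber_eq_zero_of_not_sep T S u w ho1 ho3 (S t) v hpq hv hsep
      rw [← this]
      symm
      refine Finset.sum_eq_single_of_mem t (Finset.mem_filter.mpr ⟨‹t ∈ T›, rfl⟩) fun t' ht' hne => ?_
      -- every other term of the fiber also vanishes: the fiber does not separate the collision
      have hS : S t' = S t := (Finset.mem_filter.mp ht').2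
      by_cases hp : p ∈ S t
      · have hq : q ∈ S t := by
          by_contra hq; exact hsep (Or.inl ⟨hp, hq⟩)
        exact mul_eq_zero_of_mem_mem S u w ho1 t' v (hS ▸ hp) (hS ▸ hq) hpq hv
      · have hq : q ∉ S t := fun hq => hsep (Or.inr ⟨hp, hq⟩)
        exact mul_eq_zero_of_not_mem_not_mem S u w ho3 t' v (hS ▸ hp) (hS ▸ hq) hpq hv
  rw [Finset.sum_congr rfl key, Finset.sum_comm]
  refine Finset.sum_congr rfl fun S₀ _ => ?_
  rw [Finset.sum_filter]

/-- The weight of a slot set only depends on its flattening `{S₀, S₀ᶜ}`. [folklore] -/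
theorem weight_compl (S₀ : Finset (Fin 5)) :
    (S₀ᶜ).card.factorial * (5 - (S₀ᶜ).card).factorial = S₀.card.factorial * (5 - S₀.card).factorial := by
  have h : (S₀ᶜ).card = 5 - S₀.card := by
    rw [Finset.card_compl, Fintype.card_fin]
  have hle : S₀.card ≤ 5 := by
    simpa only [Fintype.card_fin] using Finset.card_le_univ S₀
  rw [h, Nat.sub_sub_self hle, Nat.mul_comm]

/-- **Weight from occupied flattenings.**  If `R` is a finset of slot sets, pairwise distinct and pairwise non-complementary,
and every flattening `{S₀, S₀ᶜ}`, `S₀ ∈ R`, carries at least one term of `T`, then the Laplace weight of `T` is at least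
`∑_{S₀ ∈ R} |S₀|!(5−|S₀|)!`. [folklore] -/
theorem weight_ge_of_fibers (R : Finset (Finset (Fin 5)))
    (hR : ∀ S₀ ∈ R, ∀ S₁ ∈ R, S₁ ≠ S₀ᶜ)
    (hocc : ∀ S₀ ∈ R, ∃ t ∈ T, S t = S₀ ∨ S t = S₀ᶜ) :
    ∑ S₀ ∈ R, S₀.card.factorial * (5 - S₀.card).factorial
      ≤ ∑ t ∈ T, (S t).card.factorial * (5 - (S t).card).factorial := by
  classical
  -- the terms whose flattening lies in `R`, grouped by the member of `R` they belong to
  have hdisj : ∀ S₀ ∈ R, ∀ S₁ ∈ R, S₀ ≠ S₁ →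
      Disjoint (T.filter (fun t => S t = S₀ ∨ S t = S₀ᶜ)) (T.filter (fun t => S t = S₁ ∨ S t = S₁ᶜ)) := by
    intro S₀ h₀ S₁ h₁ hne
    refine Finset.disjoint_filter.mpr fun t _ ht0 ht1 => ?_
    rcases ht0 with h0 | h0 <;> rcases ht1 with h1 | h1
    · exact hne (h0.symm.trans h1)
    · exact hR S₀ h₀ S₁ h₁ (by rw [← h0, h1, compl_compl])
    · exact hR S₁ h₁ S₀ h₀ (by rw [← h1, h0, compl_compl])
    · exact hne (compl_injective (h0.symm.trans h1))
  calc ∑ S₀ ∈ R, S₀.card.factorial * (5 - S₀.card).factorial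
      ≤ ∑ S₀ ∈ R, ∑ t ∈ T.filter (fun t => S t = S₀ ∨ S t = S₀ᶜ),
          (S t).card.factorial * (5 - (S t).card).factorial := by
        refine Finset.sum_le_sum fun S₀ h₀ => ?_
        obtain ⟨t, htT, ht⟩ := hocc S₀ h₀
        have hmem : t ∈ T.filter (fun t => S t = S₀ ∨ S t = S₀ᶜ) := Finset.mem_filter.mpr ⟨htT, ht⟩
        have hwt : (S t).card.factorial * (5 - (S t).card).factorial
            = S₀.card.factorial * (5 - S₀.card).factorial := by
          rcases ht with ht | ht
          · rw [ht]
          · rw [ht, weight_compl]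
        rw [← hwt]
        exact Finset.single_le_sum (f := fun t => (S t).card.factorial * (5 - (S t).card).factorial)
          (fun _ _ => Nat.zero_le _) hmem
    _ = ∑ t ∈ R.biUnion (fun S₀ => T.filter (fun t => S t = S₀ ∨ S t = S₀ᶜ)),
          (S t).card.factorial * (5 - (S t).card).factorial := (Finset.sum_biUnion hdisj).symm
    _ ≤ ∑ t ∈ T, (S t).card.factorial * (5 - (S t).card).factorial :=
        Finset.sum_le_sum_of_subset_of_nonneg (Finset.biUnion_subset.mpr fun S₀ _ => Finset.filter_subset _ _)
          (fun _ _ _ => Nat.zero_le _)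

/-- A term on the empty or the full slot set alone weighs `5! = 120`. [folklore] -/
theorem weight_ge_of_trivial_split (t₀ : Fin N) (ht₀ : t₀ ∈ T) (h : S t₀ = ∅ ∨ S t₀ = Finset.univ) :
    Nat.factorial 5 ≤ ∑ t ∈ T, (S t).card.factorial * (5 - (S t).card).factorial := by
  have hwt : (S t₀).card.factorial * (5 - (S t₀).card).factorial = Nat.factorial 5 := by
    rcases h with h | h
    · rw [h]; decide
    · rw [h, Finset.card_univ, Fintype.card_fin]; decide
  rw [← hwt]
  exact Finset.single_le_sum (f := fun t => (S t).card.factorial * (5 - (S t).card).factorial)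
    (fun _ _ => Nat.zero_le _) ht₀

end LaplaceFiveOnShell

end Summit.ValiantsHypothesis.ValiantsHypothesis.Theorems.RigidityForcesSymmetryRankRigidMinimalRepr
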